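import Literature.AlgebraicGeometry.Deformation.CanonicalRestrictedLiftQuot
import Literature.AlgebraicGeometry.Deformation.ExtensionAutomorphismsClosedFibreQuot
import HarnessLib

/-!
# The canonical restricted lift under a base isomorphism, and readings under conjugation ([Hartshorne2010] Thm. 10.2 (a) proof,
# Remark 10.2.2; [Oort1971] Lemma (2.2.4))

Layer `Literature/AlgebraicGeometry/Deformation`, namespace `Literature.AlgebraicGeometry.Deformation.CanonicalLiftBaseChangeQuot`.
PROOF FILE, THEOREMS ONLY (no definition, no instance, no notation, no named fact, no `sorry`); ring level, index-free — the (U-can) sequel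
consumed by the atlas transport `SmoothLiftAtlasTransportQuot` (cell `hodgecm-mathlib`, P6 sub-desk P6b, deal (vii-d) «ATLAS TRANSPORT ∕
NATURALITY»; count-neutral ★ capital).  Quotient currency throughout.

THE PRINT. [Oort1971, Lemma (2.2.4), p. 274]: local lifts are unique up to isomorphism; [Hartshorne2010, Thm. 10.2 (a) (proof), p. 81 and
Cor. 10.3 (a), p. 82]: there is just ONE obstruction (it does not depend on the choices); [Hartshorne2010, Remark 10.2.2, p. 82]: the automorphisms of
an extension over the identity are `H⁰(X₀, 𝒯⁰ ⊗ J)` ((10.1.1) glued) — the currency of readings.  When the scheme being lifted is moved by an isomorphism, the chart rings of sections move by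
ring isomorphisms `s : Q' ≃ Q` compatible with the restrictions (`g ∘ s = s₁ ∘ g'`); a local lift `r' : P ↠ Q'` is read as the lift `s ∘ r' : P ↠ Q`
with the SAME chart `P`, and the canonical restricted lifts of ★ (U-can) `CanonicalRestrictedLiftQuot` on the two sides are localisations of `P` at
EQUAL submonoids — whence one canonical identification `τ`, over `P`, compatible with reductions and restrictions.  §2 is the matching statement
for readings: automorphisms of two flat lifts that are conjugate under an identification `e` lying over a closed-fibre isomorphism `s̄` have
`s̄`-conjugate readings, and conversely (★ (χ4) `comp_autOfClosedFibreDerivation_iff`).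

* §1 `liftSubmonoid_comp_algEquiv` (`liftSubmonoid (s ∘ r') g = liftSubmonoid r' g'`), **`exists_transportEquiv`** (`τ : L(s ∘ r', g) ≃ₐ[A'] L(r', g')`
  over `P`), `transportEquiv_unique`, `transportEquiv_symm_algebraMap`, `reduction_transportEquiv` (`red = s₁ ∘ red' ∘ τ`), `restrict_transportEquiv`.
* §2 **`reading_of_conj`** (`θ₁ = e θ₂ e⁻¹`, `θ⁽ⁱ⁾_{δᵢ} = θᵢ` ⟹ `δ₁ (s̄ x) = (s̄ ⊗ 1)(δ₂ x)`) and **`autOfClosedFibreDerivation_of_conj`** (converse).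

HC_CM is proved only modulo the printed citations until rung 0 closes; nothing here bears on a summit statement.
## References
* [Hartshorne2010] R. Hartshorne, *Deformation Theory*, GTM 257, Springer (2010): Thm. 10.2 (a) and its proof (p. 81), Cor. 10.3 (a) (p. 82),
  Remark 10.1.1 (p. 81), Remark 10.2.2 (p. 82).
* [Oort1971] F. Oort, *Finite group schemes, local moduli for abelian varieties, and lifting problems*, Compositio Math. 23 (1971),
  Lemma (2.2.4) (p. 274), §2.2 (pp. 277–279).
* [StacksProject] The Stacks Project, Tag 00CP (maps out of a localisation).
-/

noncomputable section

open scoped TensorProduct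

universe u

namespace Literature.AlgebraicGeometry.Deformation.CanonicalLiftBaseChangeQuot

open Literature.AlgebraicGeometry.Deformation.CanonicalLiftQuot Literature.AlgebraicGeometry.Deformation.ExtensionAutomorphismsQuot
  Literature.AlgebraicGeometry.Deformation.LiftLocalizationQuot

/-! ## §1 Ring level: the canonical restricted lift read through base isomorphisms -/

section Ring

variable {A' : Type u} [CommRing A'] {P : Type u} [CommRing P] [Algebra A' P]
  {Q : Type u} [CommRing Q] [Algebra A' Q] {Q' : Type u} [CommRing Q'] [Algebra A' Q']
  {Q₁ : Type u} [CommRing Q₁] {Q'₁ : Type u} [CommRing Q'₁] {Q₂ : Type u} [CommRing Q₂] {Q'₂ : Type u} [CommRing Q'₂]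
  (r' : P →ₐ[A'] Q') (s : Q' ≃ₐ[A'] Q) (g' : Q' →+* Q'₁) (g : Q →+* Q₁) (s₁ : Q'₁ ≃+* Q₁) (hsg : ∀ q, g (s q) = s₁ (g' q))

include hsg in
/-- **Equal submonoids:** an element of the lift is invertible on the smaller open of `X₀` iff it is on the corresponding open of `X₀'`
(`g ∘ s = s₁ ∘ g'`, and `s₁` preserves and reflects units). [cite: Hartshorne2010, Thm. 10.2 (a) (proof), p. 81] -/
theorem liftSubmonoid_comp_algEquiv : liftSubmonoid ((s : Q' →ₐ[A'] Q).comp r') g = liftSubmonoid r' g' := by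
  ext p
  rw [mem_liftSubmonoid_iff, mem_liftSubmonoid_iff]
  change IsUnit (g (s (r' p))) ↔ IsUnit (g' (r' p))
  rw [hsg]
  exact ⟨fun h => by simpa using h.map s₁.symm, fun h => h.map s₁⟩

include hsg in
/-- **THE CHART-LIFT IDENTIFICATION `τ : L(s ∘ r', g) ≃ₐ[A'] L(r', g')` over `P`** exists (both are localisations of `P` at the same submonoid).
[cite: Oort1971, Lemma (2.2.4) (p. 274)] [cite: StacksProject, Tag 00CP] -/
theorem exists_transportEquiv :
    ∃ τ : CanonicalLift ((s : Q' →ₐ[A'] Q).comp r') g ≃ₐ[A'] CanonicalLift r' g',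
      ∀ p, τ (algebraMap P _ p) = algebraMap P _ p := by
  haveI : IsLocalization (liftSubmonoid ((s : Q' →ₐ[A'] Q).comp r') g) (CanonicalLift r' g') := by
    rw [liftSubmonoid_comp_algEquiv r' s g' g s₁ hsg]
    infer_instance
  exact ⟨(IsLocalization.algEquiv (liftSubmonoid ((s : Q' →ₐ[A'] Q).comp r') g)
      (CanonicalLift ((s : Q' →ₐ[A'] Q).comp r') g) (CanonicalLift r' g')).restrictScalars A',
    fun p => (IsLocalization.algEquiv (liftSubmonoid ((s : Q' →ₐ[A'] Q).comp r') g)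
      (CanonicalLift ((s : Q' →ₐ[A'] Q).comp r') g) (CanonicalLift r' g')).commutes p⟩

/-- … and is unique: an `A'`-algebra isomorphism `L(s ∘ r', g) ≃ L(r', g')` over `P` is determined (maps out of a localisation).
[cite: StacksProject, Tag 00CP] -/
theorem transportEquiv_unique (τ τ₀ : CanonicalLift ((s : Q' →ₐ[A'] Q).comp r') g ≃ₐ[A'] CanonicalLift r' g')
    (hτ : ∀ p, τ (algebraMap P _ p) = algebraMap P _ p) (hτ₀ : ∀ p, τ₀ (algebraMap P _ p) = algebraMap P _ p) : τ = τ₀ :=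
  AlgEquiv.coe_toAlgHom_injective (algHom_ext_of_isLocalization (liftSubmonoid ((s : Q' →ₐ[A'] Q).comp r') g)
    (τ : CanonicalLift ((s : Q' →ₐ[A'] Q).comp r') g →ₐ[A'] CanonicalLift r' g')
    (τ₀ : CanonicalLift ((s : Q' →ₐ[A'] Q).comp r') g →ₐ[A'] CanonicalLift r' g') fun p => by
      change τ (algebraMap P _ p) = τ₀ (algebraMap P _ p)
      rw [hτ, hτ₀])

/-- `τ⁻¹` is over `P` as well. [cite: StacksProject, Tag 00CP] -/
theorem transportEquiv_symm_algebraMap (τ : CanonicalLift ((s : Q' →ₐ[A'] Q).comp r') g ≃ₐ[A'] CanonicalLift r' g')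
    (hτ : ∀ p, τ (algebraMap P _ p) = algebraMap P _ p) (p : P) : τ.symm (algebraMap P _ p) = algebraMap P _ p :=
  τ.injective (by rw [AlgEquiv.apply_symm_apply, hτ])

include hsg in
/-- **`τ` is compatible with the canonical reductions:** `red (x) = s₁ (red' (τ x))`. [cite: Hartshorne2010, Thm. 10.2 (a) (proof), p. 81] -/
theorem reduction_transportEquiv [Algebra A' Q₁] [Algebra A' Q'₁]
    (hg : ∀ a, g (algebraMap A' Q a) = algebraMap A' Q₁ a) (hg' : ∀ a, g' (algebraMap A' Q' a) = algebraMap A' Q'₁ a)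
    (τ : CanonicalLift ((s : Q' →ₐ[A'] Q).comp r') g ≃ₐ[A'] CanonicalLift r' g') (hτ : ∀ p, τ (algebraMap P _ p) = algebraMap P _ p)
    (x : CanonicalLift ((s : Q' →ₐ[A'] Q).comp r') g) :
    reduction ((s : Q' →ₐ[A'] Q).comp r') g hg x = s₁ (reduction r' g' hg' (τ x)) := by
  have key : (reduction ((s : Q' →ₐ[A'] Q).comp r') g hg).toRingHom =
      (s₁.toRingHom.comp (reduction r' g' hg').toRingHom).comp τ.toRingEquiv.toRingHom :=
    IsLocalization.ringHom_ext (liftSubmonoid ((s : Q' →ₐ[A'] Q).comp r') g) (RingHom.ext fun p => by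
      change reduction _ g hg (algebraMap P _ p) = s₁ (reduction r' g' hg' (τ (algebraMap P _ p)))
      rw [reduction_algebraMap, hτ, reduction_algebraMap]
      exact hsg (r' p))
  exact congrArg (fun f : _ →+* Q₁ => f x) key

/-- **`τ` is compatible with the canonical restrictions** to a deeper open (`g₂ = k ∘ g` on `X₀`, `g'₂ = k' ∘ g'` on `X₀'`, identified by `s₂`).
[cite: Hartshorne2010, Thm. 10.2 (a) (proof), p. 81] [cite: StacksProject, Tag 00CP] -/
theorem restrict_transportEquiv (g'₂ : Q' →+* Q'₂) (g₂ : Q →+* Q₂)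
    (hle : liftSubmonoid ((s : Q' →ₐ[A'] Q).comp r') g ≤ liftSubmonoid ((s : Q' →ₐ[A'] Q).comp r') g₂)
    (hle' : liftSubmonoid r' g' ≤ liftSubmonoid r' g'₂)
    (τ₁ : CanonicalLift ((s : Q' →ₐ[A'] Q).comp r') g ≃ₐ[A'] CanonicalLift r' g') (hτ₁ : ∀ p, τ₁ (algebraMap P _ p) = algebraMap P _ p)
    (τ₂ : CanonicalLift ((s : Q' →ₐ[A'] Q).comp r') g₂ ≃ₐ[A'] CanonicalLift r' g'₂) (hτ₂ : ∀ p, τ₂ (algebraMap P _ p) = algebraMap P _ p)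
    (x : CanonicalLift ((s : Q' →ₐ[A'] Q).comp r') g) :
    τ₂ (restrict ((s : Q' →ₐ[A'] Q).comp r') g g₂ hle x) = restrict r' g' g'₂ hle' (τ₁ x) := by
  have key : (τ₂ : _ →ₐ[A'] _).comp (restrict ((s : Q' →ₐ[A'] Q).comp r') g g₂ hle) =
      (restrict r' g' g'₂ hle').comp (τ₁ : _ →ₐ[A'] _) :=
    algHom_ext_of_isLocalization (liftSubmonoid ((s : Q' →ₐ[A'] Q).comp r') g) _ _ fun p => by
      change τ₂ (restrict _ g g₂ hle (algebraMap P _ p)) = restrict r' g' g'₂ hle' (τ₁ (algebraMap P _ p))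
      rw [restrict_algebraMap, hτ₂, hτ₁, restrict_algebraMap]
  exact congrArg (fun f : _ →ₐ[A'] _ => f x) key

end Ring

/-! ## §2 Readings under an identification of lifts lying over a closed-fibre isomorphism -/

section Reading

variable {A' : Type u} [CommRing A'] (𝔪 J : Ideal A') (h𝔪J : 𝔪 * J = ⊥) (hJ𝔪 : J ≤ 𝔪)
  {T₁ : Type u} [CommRing T₁] [Algebra A' T₁] [Module.Flat A' T₁] {T₂ : Type u} [CommRing T₂] [Algebra A' T₂] [Module.Flat A' T₂]
  {B₁ : Type u} [CommRing B₁] [Algebra A' B₁] {B₂ : Type u} [CommRing B₂] [Algebra A' B₂]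
  (ρ₁ : T₁ →ₐ[A'] B₁) (hρ₁ : Function.Surjective ρ₁) (hker₁ : RingHom.ker ρ₁ = 𝔪.map (algebraMap A' T₁))
  (ρ₂ : T₂ →ₐ[A'] B₂) (hρ₂ : Function.Surjective ρ₂) (hker₂ : RingHom.ker ρ₂ = 𝔪.map (algebraMap A' T₂))
  (e : T₁ ≃ₐ[A'] T₂) (sbar : B₂ ≃ₐ[A'] B₁) (he : ∀ y, ρ₁ (e.symm y) = sbar (ρ₂ y))

include he in
/-- **Conjugate automorphisms over a closed-fibre isomorphism have conjugate readings** ((10.1.1) is natural, ★ (χ4)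
`comp_autOfClosedFibreDerivation_iff` along `e⁻¹` over `s̄`): if `θ₁ = e θ₂ e⁻¹`, `θ⁽¹⁾_{δ₁} = θ₁`, `θ⁽²⁾_{δ₂} = θ₂`, then
`δ₁ (s̄ x) = (s̄ ⊗ 1)(δ₂ x)`. [cite: Hartshorne2010, Remark 10.2.2, p. 82] [cite: Hartshorne2010, Thm. 10.2 (a) (proof), p. 81] -/
theorem reading_of_conj {θ₁ : T₁ ≃ₐ[A'] T₁} {θ₂ : T₂ ≃ₐ[A'] T₂} (hθ : θ₁ = e.trans (θ₂.trans e.symm))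
    {δ₁ : Derivation A' B₁ (B₁ ⊗[A'] ↥J)} {δ₂ : Derivation A' B₂ (B₂ ⊗[A'] ↥J)}
    (h₁ : autOfClosedFibreDerivation 𝔪 J h𝔪J hJ𝔪 ρ₁ hρ₁ hker₁ δ₁ = θ₁)
    (h₂ : autOfClosedFibreDerivation 𝔪 J h𝔪J hJ𝔪 ρ₂ hρ₂ hker₂ δ₂ = θ₂) (x : B₂) :
    δ₁ (sbar x) = LinearMap.rTensor ↥J sbar.toLinearMap (δ₂ x) := by
  have key := (comp_autOfClosedFibreDerivation_iff 𝔪 J h𝔪J hJ𝔪 ρ₂ hρ₂ hker₂ ρ₁ hρ₁ hker₁ e.symm.toAlgHom sbar.toAlgHom he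
    δ₂ δ₁).1 (fun b => by
      rw [h₁, h₂, hθ]
      change e.symm (θ₂ b) = e.symm (θ₂ (e (e.symm b)))
      rw [AlgEquiv.apply_symm_apply]) x
  rw [AlgEquiv.toAlgHom_toLinearMap] at key
  exact key

include he in
/-- **Converse:** if `δ₁ (s̄ x) = (s̄ ⊗ 1)(δ₂ x)` and `θ⁽²⁾_{δ₂} = θ₂`, then `θ⁽¹⁾_{δ₁} = e θ₂ e⁻¹`.
[cite: Hartshorne2010, Remark 10.2.2, p. 82] [cite: Hartshorne2010, Thm. 10.2 (a) (proof), p. 81] -/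
theorem autOfClosedFibreDerivation_of_conj {θ₂ : T₂ ≃ₐ[A'] T₂}
    {δ₁ : Derivation A' B₁ (B₁ ⊗[A'] ↥J)} {δ₂ : Derivation A' B₂ (B₂ ⊗[A'] ↥J)}
    (hδ : ∀ x, δ₁ (sbar x) = LinearMap.rTensor ↥J sbar.toLinearMap (δ₂ x))
    (h₂ : autOfClosedFibreDerivation 𝔪 J h𝔪J hJ𝔪 ρ₂ hρ₂ hker₂ δ₂ = θ₂) :
    autOfClosedFibreDerivation 𝔪 J h𝔪J hJ𝔪 ρ₁ hρ₁ hker₁ δ₁ = e.trans (θ₂.trans e.symm) := by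
  have hint := (comp_autOfClosedFibreDerivation_iff 𝔪 J h𝔪J hJ𝔪 ρ₂ hρ₂ hker₂ ρ₁ hρ₁ hker₁ e.symm.toAlgHom sbar.toAlgHom he
    δ₂ δ₁).2 (fun y => by rw [AlgEquiv.toAlgHom_toLinearMap]; exact hδ y)
  refine AlgEquiv.ext fun y => ?_
  rw [AlgEquiv.trans_apply, AlgEquiv.trans_apply, ← h₂]
  have h1 := hint (e y)
  change e.symm (autOfClosedFibreDerivation 𝔪 J h𝔪J hJ𝔪 ρ₂ hρ₂ hker₂ δ₂ (e y)) =
    autOfClosedFibreDerivation 𝔪 J h𝔪J hJ𝔪 ρ₁ hρ₁ hker₁ δ₁ (e.symm (e y)) at h1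
  rw [AlgEquiv.symm_apply_apply] at h1
  exact h1.symm

end Reading

end Literature.AlgebraicGeometry.Deformation.CanonicalLiftBaseChangeQuot

end
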